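import Summits.Ventures.PercRepro.C025ProfilePLDBridgeTruncate

/-!
# PER-LAYER DOMINANCE IS PRESERVED BY TRUNCATION (night-3 g30)

`proofs/NIGHT3-G30-PAREXT.md` §6.  Truncating a matroid to rank `r` caps both ranks of the profile: the pair `(x, f)` becomes
`(min x r, min f r)`.  An instance `(lo, hi, δ, Θ)` of PER-LAYER DOMINANCE on the capped family is TRIVIAL when
`r ≤ hi + δ` (every non-zero left term `[lo ≤ X ≤ hi ∧ Θ ≤ X + F]·C(F, δ)` has `lo + δ ≤ F ≤ r ≤ hi + δ`, so the same term
sits on the right) and otherwise DOMINATED TERMWISE by the same instance on the original family (`hi < r` forces `X = x` on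
the left window, `C(F, δ) ≤ C(f, δ)`, and the right window `[lo+δ, hi+δ]` lies below `r`, where `F = f`).  So (PLD) passes
from any family to its capped family (`pld_truncate_family`) and from a finite matroid `M` to every truncation
`PercRepro.Matroid.truncate M r` (`pld_truncate`, the hPLD binder of the landed bridge verbatim) — hence C-025 at every `(p, q)`
on every truncation of «T_r(M) ⊕ free points» (`rls_truncate_disjointSum_freeOn_of_pld_truncate`).  With the parallel-extension
and parallel-class closures, (PLD) now holds on everything generated from the paving / rank ≤ 3 / simplification-paving
matroids by ⊕ free points, ⊕ parallel classes, parallel extension, loops and truncation — e.g. the first simple rank-4 family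
`T_4(U_{2,k} ⊕ U_{m,m})` (`U_{4,m+k}` with `k` collinear points).  No `def`, no `instance`, no notation.  Axioms: standard.
-/

open scoped Matroid

namespace PercRepro

open Finset ThmH

namespace PLDTruncate

variable {ι : Type} {α : Type} [DecidableEq α]

/-- PER-LAYER DOMINANCE PASSES TO THE CAPPED FAMILY `(min x r, min f r)`, for every `r`. -/
theorem pld_truncate_family (s : Finset ι) (x f : ι → ℕ)
    (h : ∀ lo hi δ Θ : ℕ, Θ ≤ lo + hi + δ → (lo = 0 ∨ lo + hi + δ ≤ Θ) →
      ∑ i ∈ s, (if lo ≤ x i ∧ x i ≤ hi ∧ Θ ≤ f i + x i then (f i).choose δ else 0) ≤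
        ∑ i ∈ s, (if lo + δ ≤ f i ∧ f i ≤ hi + δ then (f i).choose δ else 0))
    (r : ℕ) :
    ∀ lo hi δ Θ : ℕ, Θ ≤ lo + hi + δ → (lo = 0 ∨ lo + hi + δ ≤ Θ) →
      ∑ i ∈ s, (if lo ≤ min (x i) r ∧ min (x i) r ≤ hi ∧ Θ ≤ min (f i) r + min (x i) r then
          (min (f i) r).choose δ else 0) ≤
        ∑ i ∈ s, (if lo + δ ≤ min (f i) r ∧ min (f i) r ≤ hi + δ then (min (f i) r).choose δ else 0) := by
  intro lo hi δ Θ hΘ hlo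
  rcases le_or_gt r (hi + δ) with hr | hr
  · -- `r ≤ hi + δ`: the instance is trivial, termwise
    refine Finset.sum_le_sum fun i _ => ?_
    have hF : min (f i) r ≤ r := min_le_right _ _
    split_ifs with h1 h2
    · exact le_rfl
    · -- the left term is present but the right window misses `F`: then `F < lo + δ`, and `F < δ` or a contradiction
      rcases Nat.lt_or_ge (min (f i) r) δ with hlt | hge
      · rw [Nat.choose_eq_zero_of_lt hlt]
      · exfalso
        rcases hlo with h0 | h0
        · exact h2 ⟨by omega, by omega⟩
        · exact h2 ⟨by omega, by omega⟩
    · exact Nat.zero_le _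
    · exact le_rfl
  · -- `hi + δ < r`: the same instance on the original family dominates termwise
    have key := h lo hi δ Θ hΘ hlo
    refine le_trans (Finset.sum_le_sum fun i _ => ?_) (le_trans key (Finset.sum_le_sum fun i _ => ?_))
    · have hF : min (f i) r ≤ f i := min_le_left _ _
      split_ifs with h1 h2
      · exact Nat.choose_le_choose δ hF
      · exfalso
        have hx : min (x i) r = x i := min_eq_left (by omega)
        exact h2 ⟨by omega, by omega, by omega⟩
      · exact Nat.zero_le _
      · exact le_rfl
    · split_ifs with h1 h2
      · have hf : min (f i) r = f i := min_eq_left (by omega)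
        rw [hf]
      · exfalso
        have hf : min (f i) r = f i := min_eq_left (by omega)
        exact h2 ⟨by omega, by omega⟩
      · exact Nat.zero_le _
      · exact le_rfl

omit [DecidableEq α] in
/-- The `ℕ`-valued rank of a truncation is the capped rank. -/
theorem toNat_truncate_eRk (M : Matroid α) [M.Finite] (r : ℕ) (X : Set α) :
    ((Matroid.truncate M r).eRk X).toNat = min (M.eRk X).toNat r := by
  rw [Matroid.truncate_eRk]
  obtain ⟨a, ha⟩ : ∃ a : ℕ, M.eRk X = a :=
    ⟨_, (ENat.coe_toNat (ne_top_of_le_ne_top (M.eRank_ne_top_iff.2 inferInstance) (M.eRk_le_eRank X))).symm⟩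
  rw [ha, ENat.toNat_coe]
  rcases le_total a r with h | h
  · rw [min_eq_left (by exact_mod_cast h), ENat.toNat_coe, min_eq_left h]
  · rw [min_eq_right (by exact_mod_cast h), ENat.toNat_coe, min_eq_right h]

/-- PER-LAYER DOMINANCE IS PRESERVED BY TRUNCATION: if the finite matroid `M` satisfies the hPLD binder of
`PLDBridge.rls_disjointSum_freeOn_of_pld`, so does `PercRepro.Matroid.truncate M r` for every `r`. -/
theorem pld_truncate (M : Matroid α) [M.Finite]
    (hPLD : ∀ lo hi δ Θ : ℕ, Θ ≤ lo + hi + δ → (lo = 0 ∨ lo + hi + δ ≤ Θ) →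
      (∑ I ∈ (gr M).powerset, (if lo ≤ (M.eRk (I : Set α)).toNat ∧ (M.eRk (I : Set α)).toNat ≤ hi ∧
          Θ ≤ (M.eRk ((gr M \ I : Finset α) : Set α)).toNat + (M.eRk (I : Set α)).toNat then
          ((M.eRk ((gr M \ I : Finset α) : Set α)).toNat).choose δ else 0)) ≤
        ∑ I ∈ (gr M).powerset, (if lo + δ ≤ (M.eRk ((gr M \ I : Finset α) : Set α)).toNat ∧
          (M.eRk ((gr M \ I : Finset α) : Set α)).toNat ≤ hi + δ then
          ((M.eRk ((gr M \ I : Finset α) : Set α)).toNat).choose δ else 0))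
    (r : ℕ) :
    ∀ lo hi δ Θ : ℕ, Θ ≤ lo + hi + δ → (lo = 0 ∨ lo + hi + δ ≤ Θ) →
      (∑ I ∈ (gr (Matroid.truncate M r)).powerset,
        (if lo ≤ ((Matroid.truncate M r).eRk (I : Set α)).toNat ∧
            ((Matroid.truncate M r).eRk (I : Set α)).toNat ≤ hi ∧
            Θ ≤ ((Matroid.truncate M r).eRk ((gr (Matroid.truncate M r) \ I : Finset α) : Set α)).toNat +
              ((Matroid.truncate M r).eRk (I : Set α)).toNat then
          (((Matroid.truncate M r).eRk ((gr (Matroid.truncate M r) \ I : Finset α) : Set α)).toNat).choose δ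
        else 0)) ≤
      ∑ I ∈ (gr (Matroid.truncate M r)).powerset,
        (if lo + δ ≤ ((Matroid.truncate M r).eRk ((gr (Matroid.truncate M r) \ I : Finset α) : Set α)).toNat ∧
            ((Matroid.truncate M r).eRk ((gr (Matroid.truncate M r) \ I : Finset α) : Set α)).toNat ≤ hi + δ then
          (((Matroid.truncate M r).eRk ((gr (Matroid.truncate M r) \ I : Finset α) : Set α)).toNat).choose δ
        else 0) := by
  intro lo hi δ Θ hΘ hlo
  have key := pld_truncate_family (gr M).powerset (fun I : Finset α => (M.eRk (I : Set α)).toNat)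
    (fun I : Finset α => (M.eRk ((gr M \ I : Finset α) : Set α)).toNat) hPLD r lo hi δ Θ hΘ hlo
  beta_reduce at key
  rw [PLDBridge.gr_truncate]
  simp only [toNat_truncate_eRk]
  exact key

/-- C-025 AT EVERY `(p, q)` ON EVERY TRUNCATION OF «T_r(M) ⊕ FREE POINTS» for every finite matroid `M` satisfying
PER-LAYER DOMINANCE. -/
theorem rls_truncate_disjointSum_freeOn_of_pld_truncate (M : Matroid α) [M.Finite]
    (hPLD : ∀ lo hi δ Θ : ℕ, Θ ≤ lo + hi + δ → (lo = 0 ∨ lo + hi + δ ≤ Θ) →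
      (∑ I ∈ (gr M).powerset, (if lo ≤ (M.eRk (I : Set α)).toNat ∧ (M.eRk (I : Set α)).toNat ≤ hi ∧
          Θ ≤ (M.eRk ((gr M \ I : Finset α) : Set α)).toNat + (M.eRk (I : Set α)).toNat then
          ((M.eRk ((gr M \ I : Finset α) : Set α)).toNat).choose δ else 0)) ≤
        ∑ I ∈ (gr M).powerset, (if lo + δ ≤ (M.eRk ((gr M \ I : Finset α) : Set α)).toNat ∧
          (M.eRk ((gr M \ I : Finset α) : Set α)).toNat ≤ hi + δ then
          ((M.eRk ((gr M \ I : Finset α) : Set α)).toNat).choose δ else 0))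
    (r₀ : ℕ) (E₃ : Finset α) (h : Disjoint (Matroid.truncate M r₀).E (E₃ : Set α)) (r p q : ℕ) :
    haveI := PLDBridge.disjointSum_freeOn_finite (Matroid.truncate M r₀) E₃ h
    ThmN.RLS (PercRepro.Matroid.truncate
      ((Matroid.truncate M r₀).disjointSum (Matroid.freeOn (E₃ : Set α)) h) r) p q :=
  PLDBridge.rls_disjointSum_freeOn_of_pld (Matroid.truncate M r₀) E₃ h r p q (pld_truncate M hPLD r₀)

end PLDTruncate

end PercRepro
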